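import Literature.NumberTheory.EllipticCurves.KatzPAdicLFunctionCMFieldLocalDataProofs
import Literature.IUT.LogVolume.EisensteinRadicalDifferentExact
import Literature.IUT.LogVolume.DifferentOrdDivisor
import Literature.IUT.LogVolume.RescaledCompletionInvariants
import HarnessLib

/-!
# Local data of Katz's measure, II: the exact different exponent at the WILD quadratic primes
# (`√−1 ∈ K`: `d_w = 3e/2 − 1`; `√−2 ∈ K`: `d_w = 2e − 1`; tame square roots: `2 ∣ e`)

PROOF-ONLY sequel of `KatzPAdicLFunctionCMFieldLocalDataProofs.lean` (no definition, no named fact, no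
`sorry`). Purpose (route `BiquadraticEisensteinDescent`, crux stmt-BirchSwinnertonDyer-21341, line
`hsieh-lambda`, layer 2, Hsieh's (d2) `ord_w(2ϑ) = d_w` for `L = K′(√d_CM)`, memo
`Cruxes/EisensteinHeartFlatCMInertBadKPrime/INSTANTIATION-L-BIQUADRATIC.md` §ADDENDUM 3): at the primes
`w ∣ 2` of `L` when `d_CM ∈ {−4, −8}` (`j ∈ {1728, 287496}` resp. `j = 8000`) the different exponent is NOT
given by the tame formula `e − 1`; it is read off the abc-iut cell's EXACT local formulas (Serre, *Corps
locaux* III §6) for a `2`-adic field containing `√−1` (unit radical, type W2) resp. `√−2` (Eisenstein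
radical, type W1), through the completion dictionary `differentOrd_rescaledCompletion`
(`d = ord_w(𝒟)/e(w∣2)`) and `absRamificationIdx_rescaledCompletion` (`e(K_w) = e(w∣2)`):

* §1 `differentExponentAt_eq_of_sq_eq_neg_one` — `i² = −1` in `K`, `w ∣ 2`, `4 ∤ e(w∣2)` ⟹
  `d_w = e + e/2 − 1`; **`differentExponentAt_eq_two_of_sq_eq_neg_one`** — with `e(w∣2) = 2`: `d_w = 2`
  (the value `ord_w(2i) = 2` of the (d2) recipe for `d_CM = −4`).
* §2 `differentExponentAt_eq_of_sq_eq_neg_two` — `y² = −2` in `K`, `w ∣ 2`, `4 ∤ e(w∣2)` ⟹ `d_w = 2e − 1`;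
  **`differentExponentAt_eq_three_of_sq_eq_neg_two`** — with `e(w∣2) = 2`: `d_w = 3` (`= ord_w(2√−2)`, `d_CM = −8`).
* §3 `two_dvd_ramificationIdx_of_sq_eq_intCast` — `x² = d` in `K` with `ℓ ∥ d` (`ℓ ∣ d`, `ℓ² ∤ d`) ⟹ `2 ∣ e(w∣ℓ)` at
  every `w ∣ ℓ` (`e·1 = ord_w(d) = 2·ord_w(x)`); with `e(w∣ℓ) ≤ 2` this is `e(w∣ℓ) = 2`
  (`ramificationIdx_eq_two_of_sq_eq_intCast_of_le`), the input of the tame lemma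
  `differentExponentAt_eq_one_of_ramificationIdx_eq_two` at the odd `ℓ ∣ d_CM`.

References: [cite: SerreLocalFields1979, Ch. III §6 Prop. 13 and Remark; Cor. 2 of Prop. 11];
[cite: NeukirchANT1999, Ch. II Prop. (6.8); Ch. III §2 Thm. (2.6)]; [cite: Hsieh2014mu, §3.1 (d2)].
-/

set_option autoImplicit false

noncomputable section

open scoped nonZeroDivisors NumberField

namespace Literature.NumberTheory.EllipticCurves

open NumberField IsDedekindDomain Literature.IUT.LogVolume Literature.NumberTheory.NumberFields

variable {K : Type} [Field K] [NumberField K]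

/-! ## §1 `√−1 ∈ K`: `d_w = e + e/2 − 1` at `w ∣ 2` (`4 ∤ e`) -/

/-- **`i² = −1` in `K`, `w ∣ 2`, `4 ∤ e(w∣2)` ⟹ `d_w = e(w∣2) + e(w∣2)/2 − 1`** (Serre's type-W2 exact formula for the
`2`-adic field `K_w ∋ i`, `i² = u = −1`, `‖u − 1‖₂ = 2⁻¹`, read through the completion dictionary).
[cite: SerreLocalFields1979, Ch. III §6 Prop. 13 and Remark] [cite: NeukirchANT1999, Ch. II Prop. (6.8)] -/
theorem differentExponentAt_eq_of_sq_eq_neg_one {i : K} (hi : i ^ 2 = -1) (w : HeightOneSpectrum (𝓞 K))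
    (hw : ((2 : ℕ) : 𝓞 K) ∈ w.asIdeal) (h4 : ¬ 4 ∣ w.asIdeal.ramificationIdx ℤ) :
    differentExponentAt w =
      ((w.asIdeal.ramificationIdx ℤ + w.asIdeal.ramificationIdx ℤ / 2 - 1 : ℕ) : ℤ) := by
  haveI : Fact (Nat.Prime 2) := ⟨Nat.prime_two⟩
  letI : Algebra K (RescaledCompletion K 2 w hw) := inferInstanceAs (Algebra K (w.adicCompletion K))
  have hu' : ‖(-1 : ℚ_[2]) ^ (2 - 1) - 1‖ = ((2 : ℕ) : ℝ)⁻¹ := by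
    rw [show (2 - 1 : ℕ) = 1 from rfl, pow_one, show (-1 : ℚ_[2]) - 1 = -(2 : ℚ_[2]) by ring, norm_neg]
    exact_mod_cast Padic.norm_p (p := 2)
  have hy : (algebraMap K (RescaledCompletion K 2 w hw) i) ^ 2 =
      algebraMap ℚ_[2] (RescaledCompletion K 2 w hw) (-1) := by
    rw [← map_pow, hi, map_neg, map_one, map_neg, map_one]
  have he2 : ¬ 2 ^ 2 ∣ absRamificationIdx 2 (RescaledCompletion K 2 w hw) := by
    rw [absRamificationIdx_rescaledCompletion]
    exact h4
  have h := differentOrd_eq_of_pow_prime_eq_unit 2 hu' hy he2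
  rw [differentOrd_rescaledCompletion, absRamificationIdx_rescaledCompletion] at h
  have he0 : (0 : ℝ) < (w.asIdeal.ramificationIdx ℤ : ℝ) := by exact_mod_cast Ideal.ramificationIdx_pos _ _
  rw [div_left_inj' he0.ne'] at h
  rw [differentExponentAt_eq_multiplicity]
  exact_mod_cast h

/-- **`i² = −1` in `K` and `e(w∣2) = 2` ⟹ `d_w = 2`** (`= ord_w(2)`; the (d2) value at `w ∣ 2` for
`d_CM = −4`, where `2ϑ₀ = √−4 = 2i`). [cite: SerreLocalFields1979, Ch. III §6 Prop. 13 and Remark] -/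
theorem differentExponentAt_eq_two_of_sq_eq_neg_one {i : K} (hi : i ^ 2 = -1) (w : HeightOneSpectrum (𝓞 K))
    (hw : ((2 : ℕ) : 𝓞 K) ∈ w.asIdeal) (he : w.asIdeal.ramificationIdx ℤ = 2) : differentExponentAt w = 2 := by
  rw [differentExponentAt_eq_of_sq_eq_neg_one hi w hw (by rw [he]; decide), he]
  norm_num

/-! ## §2 `√−2 ∈ K`: `d_w = 2e − 1` at `w ∣ 2` (`4 ∤ e`) -/

/-- **`y² = −2` in `K`, `w ∣ 2`, `4 ∤ e(w∣2)` ⟹ `d_w = 2·e(w∣2) − 1`** (Serre's type-W1 exact formula for the `2`-adic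
field `K_w ∋ y`, `y² = π = −2`, `‖π‖₂ = 2⁻¹`: Ore's bound attained).
[cite: SerreLocalFields1979, Ch. III §6 Prop. 13 and Remark; Cor. 2 of Prop. 11] [cite: NeukirchANT1999, Ch. II Prop. (6.8)] -/
theorem differentExponentAt_eq_of_sq_eq_neg_two {y : K} (hy2 : y ^ 2 = -2) (w : HeightOneSpectrum (𝓞 K))
    (hw : ((2 : ℕ) : 𝓞 K) ∈ w.asIdeal) (h4 : ¬ 4 ∣ w.asIdeal.ramificationIdx ℤ) :
    differentExponentAt w = ((2 * w.asIdeal.ramificationIdx ℤ - 1 : ℕ) : ℤ) := by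
  haveI : Fact (Nat.Prime 2) := ⟨Nat.prime_two⟩
  letI : Algebra K (RescaledCompletion K 2 w hw) := inferInstanceAs (Algebra K (w.adicCompletion K))
  have hπ : ‖(-2 : ℚ_[2])‖ = ((2 : ℕ) : ℝ)⁻¹ := by
    rw [norm_neg]
    exact_mod_cast Padic.norm_p (p := 2)
  have hy : (algebraMap K (RescaledCompletion K 2 w hw) y) ^ 2 =
      algebraMap ℚ_[2] (RescaledCompletion K 2 w hw) (-2) := by
    rw [← map_pow, hy2, map_neg, map_neg, map_ofNat, map_ofNat]
  have he2 : ¬ 2 ^ 2 ∣ absRamificationIdx 2 (RescaledCompletion K 2 w hw) := by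
    rw [absRamificationIdx_rescaledCompletion]
    exact h4
  have h := differentOrd_eq_of_pow_prime_eq 2 hπ hy he2
  rw [differentOrd_rescaledCompletion, absRamificationIdx_rescaledCompletion] at h
  have he0 : (0 : ℝ) < (w.asIdeal.ramificationIdx ℤ : ℝ) := by exact_mod_cast Ideal.ramificationIdx_pos _ _
  rw [div_left_inj' he0.ne'] at h
  rw [differentExponentAt_eq_multiplicity]
  exact_mod_cast h

/-- **`y² = −2` in `K` and `e(w∣2) = 2` ⟹ `d_w = 3`** (`= ord_w(2√−2)`; the (d2) value at `w ∣ 2` for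
`d_CM = −8`, where `2ϑ₀ = √−8 = 2√−2`). [cite: SerreLocalFields1979, Ch. III §6 Prop. 13 and Remark] -/
theorem differentExponentAt_eq_three_of_sq_eq_neg_two {y : K} (hy2 : y ^ 2 = -2) (w : HeightOneSpectrum (𝓞 K))
    (hw : ((2 : ℕ) : 𝓞 K) ∈ w.asIdeal) (he : w.asIdeal.ramificationIdx ℤ = 2) : differentExponentAt w = 3 := by
  rw [differentExponentAt_eq_of_sq_eq_neg_two hy2 w hw (by rw [he]; decide), he]
  norm_num

/-! ## §3 A square root of an integer exactly divisible by `ℓ` forces `2 ∣ e(w∣ℓ)` -/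

/-- **`x² = d` in `K` with `ℓ ∣ d`, `ℓ² ∤ d` ⟹ `2 ∣ e(w∣ℓ)` at every `w ∣ ℓ`**: `e(w∣ℓ) = ord_w(ℓ) = ord_w(d) = 2·ord_w(x)`
(`d/ℓ` is prime to `ℓ`, hence to `w`). [cite: NeukirchANT1999, Ch. I §8 (primes lying over `p`), §11] -/
theorem two_dvd_ramificationIdx_of_sq_eq_intCast {x : K} {d : ℤ} (hx : x ^ 2 = (d : K)) {ℓ : ℕ} (hℓ : ℓ.Prime)
    (hd : (ℓ : ℤ) ∣ d) (hd2 : ¬ ((ℓ : ℤ) ^ 2) ∣ d) (w : HeightOneSpectrum (𝓞 K))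
    (hw : ((ℓ : ℕ) : 𝓞 K) ∈ w.asIdeal) : 2 ∣ w.asIdeal.ramificationIdx ℤ := by
  obtain ⟨m, rfl⟩ := hd
  have hℓ0 : (ℓ : ℤ) ≠ 0 := by exact_mod_cast hℓ.ne_zero
  have hm0 : m ≠ 0 := by
    rintro rfl
    exact hd2 ⟨0, by simp⟩
  have hmℓ : ¬ (ℓ : ℤ) ∣ m := by
    rintro ⟨k, rfl⟩
    exact hd2 ⟨k, by ring⟩
  -- `m ∉ w`: otherwise `w ∋ ℓ, m` coprime ⟹ `1 ∈ w`
  have hmw : ((m : ℤ) : 𝓞 K) ∉ w.asIdeal := by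
    intro hmem
    have hcop : IsCoprime (ℓ : ℤ) m := (Nat.prime_iff_prime_int.mp hℓ).irreducible.coprime_iff_not_dvd.mpr hmℓ
    obtain ⟨a, b, hab⟩ := hcop
    have h1 : (1 : 𝓞 K) ∈ w.asIdeal := by
      have : ((a * ℓ + b * m : ℤ) : 𝓞 K) ∈ w.asIdeal := by
        push_cast
        exact w.asIdeal.add_mem (w.asIdeal.mul_mem_left _ (by exact_mod_cast hw)) (w.asIdeal.mul_mem_left _ hmem)
      rwa [hab, Int.cast_one] at this
    exact w.isPrime.ne_top ((Ideal.eq_top_iff_one _).mpr h1)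
  have hx0 : x ≠ 0 := by
    intro h0
    rw [h0, zero_pow two_ne_zero, eq_comm, Int.cast_eq_zero] at hx
    exact mul_ne_zero hℓ0 hm0 hx
  -- `ord_w(d) = e(w|ℓ) + 0 = 2 ord_w(x)`
  have hordd : ordAt w ((ℓ : K) * (m : K)) = (w.asIdeal.ramificationIdx ℤ : ℤ) := by
    rw [ordAt_mul w (by exact_mod_cast hℓ.ne_zero) (by exact_mod_cast hm0),
      ordAt_natCast_eq_ramificationIdx hℓ w hw, ordAt_intCast_eq_zero_of_not_mem w hm0 hmw, add_zero]
  have hordx : ordAt w ((ℓ : K) * (m : K)) = 2 * ordAt w x := by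
    rw [show (ℓ : K) * (m : K) = x ^ 2 by rw [hx]; push_cast; ring, ordAt_pow]
    rfl
  have h : (w.asIdeal.ramificationIdx ℤ : ℤ) = 2 * ordAt w x := hordd.symm.trans hordx
  exact Int.natCast_dvd_natCast.mp ⟨ordAt w x, by exact_mod_cast h⟩

/-- **… and if moreover `e(w∣ℓ) ≤ 2` then `e(w∣ℓ) = 2`** (e.g. `w` above a prime unramified in a subfield of index `2`).
[cite: NeukirchANT1999, Ch. I §8] -/
theorem ramificationIdx_eq_two_of_sq_eq_intCast_of_le {x : K} {d : ℤ} (hx : x ^ 2 = (d : K)) {ℓ : ℕ}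
    (hℓ : ℓ.Prime) (hd : (ℓ : ℤ) ∣ d) (hd2 : ¬ ((ℓ : ℤ) ^ 2) ∣ d) (w : HeightOneSpectrum (𝓞 K))
    (hw : ((ℓ : ℕ) : 𝓞 K) ∈ w.asIdeal) (hle : w.asIdeal.ramificationIdx ℤ ≤ 2) :
    w.asIdeal.ramificationIdx ℤ = 2 := by
  have h2 := two_dvd_ramificationIdx_of_sq_eq_intCast hx hℓ hd hd2 w hw
  have hpos : 0 < w.asIdeal.ramificationIdx ℤ := Ideal.ramificationIdx_pos _ _
  obtain ⟨k, hk⟩ := h2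
  omega

end Literature.NumberTheory.EllipticCurves

end
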